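import Summits.CriticalPhenomena.PercolationContinuityZ3.Theorems.Transplant.FKDoubleFanOneSidedConeS
import HarnessLib

/-!
# Double fans `K₂ ∨ P_{m+1}`: the `e_v`-column functional dominates `a_uy, −a_xz, −a_yz, ±a_xy` (certificates C)

Helper file (`--supports stmt-CriticalPhenomena-4575`), FK sub-lane `prim-bschramm-fk-3` (gen 39); builds on p205010 (kernel theorem, internal
audit signed; external expert review pending).  No named facts, no sorries; standard axioms.  Memo `bschramm/prim-bschramm-fk-3/FAR-CROSS-XIV.md` §0(F).

With `ℓ(a) := a_uv + a_xv + a_yv + a_zv`: the identities behind `ℓ − a_uy`, `ℓ + a_xz`, `ℓ + a_yz`, `ℓ ∓ a_xy ≥ 0` for every `a`-image over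
`Valid × Valid` (`0 ≤ q ≤ 1`; LP certificates, kit j275845).  Used by `…ConeSSigns` (`‖a‖∞ ≤ ℓ(a)`).
[folklore]
-/

noncomputable section

namespace Summit.CriticalPhenomena.PercolationContinuityZ3.Theorems

namespace FK

namespace ThreeApex

section Identities

variable (q : ℝ) (F w : V5)

/-- `ℓ − a_uy ≥ 0` for the `a`-image `imgA q F w`: the certificate identity (non-negative combination of valid forms). [folklore] -/
theorem imgA_ell_sub_uy_eq :
    (imgA q F w).uv + (imgA q F w).xv + (imgA q F w).yv + (imgA q F w).zv - (imgA q F w).uy =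
      3 * (F.z0 * F.z0) * masterN q (swapAB w)
      + 3 * (F.z0 * F.zab) * masterN q (swapAB w)
      + 2 * (F.z0 * F.zac) * (w.z0 * w.zbc)
      + (5 / 2 : ℝ) * (F.z0 * F.zac) * (w.zab * w.zbc)
      + (1 / 2 : ℝ) * (1 - q) * (F.z0 * F.zac) * (w.zab * w.zbc)
      + (3 / 4 : ℝ) * q * (F.z0 * F.zac) * (w.zbc * w.zbc)
      + (3 / 4 : ℝ) * (2 - q) * (F.z0 * F.zac) * (w.zbc * w.zbc)
      + (F.z0 * F.zac) * masterN q (swapAB w)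
      + (3 / 2 : ℝ) * q * (F.z0 * F.zac) * masterN q (swapAB w)
      + 4 * (F.z0 * F.zbc) * masterN q (swapAB w)
      + (3 / 2 : ℝ) * q * (F.z0 * F.z1) * masterN q (swapAB w)
      + 2 * (F.zab * F.zac) * (w.z0 * w.zbc)
      + q * (F.zab * F.zac) * (w.zab * w.zbc)
      + (3 / 2 : ℝ) * (2 - q) * (F.zab * F.zac) * (w.zab * w.zbc)
      + (3 / 2 : ℝ) * (F.zab * F.zac) * (w.zbc * w.zbc)
      + (F.zab * F.zac) * masterN q (swapAB w)
      + (5 / 2 : ℝ) * (F.zab * F.zbc) * masterN q (swapAB w)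
      + (3 / 2 : ℝ) * (1 - q) * (F.zab * F.zbc) * masterN q (swapAB w)
      + q * (F.zac * F.zac) * (w.z0 * w.zbc)
      + (2 - q) * (F.zac * F.zac) * (w.z0 * w.zbc)
      + 2 * (F.zac * F.zac) * (w.zab * w.zbc)
      + (F.zac * F.zac) * masterN q (swapAB w)
      + 2 * (F.zac * F.zbc) * (w.z0 * w.zbc)
      + (5 / 2 : ℝ) * (F.zac * F.zbc) * (w.zab * w.zbc)
      + (1 / 2 : ℝ) * (1 - q) * (F.zac * F.zbc) * (w.zab * w.zbc)
      + (3 / 2 : ℝ) * (F.zac * F.zbc) * (w.zbc * w.zbc)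
      + 2 * (F.zac * F.zbc) * masterN q (swapAB w)
      + q * (F.zac * F.z1) * (w.z0 * w.zbc)
      + (2 - q) * (F.zac * F.z1) * (w.z0 * w.zbc)
      + q * (F.zac * F.z1) * (w.zab * w.zbc)
      + (2 - q) * (F.zac * F.z1) * (w.zab * w.zbc)
      + (F.zac * F.z1) * masterN q (swapAB w)
      + (F.zbc * F.zbc) * masterN q (swapAB w)
      + (F.zbc * F.z1) * masterN q (swapAB w)
      + 2 * masterN q F * (w.z0 * w.z0)
      + (3 / 2 : ℝ) * q * masterN q F * (w.z0 * w.zab)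
      + (3 / 2 : ℝ) * (2 - q) * masterN q F * (w.z0 * w.zab)
      + masterN q F * (w.zab * w.zac)
      + masterN q F * masterN q (swapBC w)
      + 2 * masterN q F * kap w
      + (1 - q) * masterN q F * kap (swapBC w)
      + (2 - q) * masterN q F * kap (swapAB w)
      + (1 / 2 : ℝ) * (2 - q) * lam F * (w.zab * w.zbc)
      + (3 / 2 : ℝ) * lam F * (w.zbc * w.zbc)
      + (1 / 2 : ℝ) * q * kap F * (w.z0 * w.zbc)
      + q * kap F * (w.zab * w.zbc)
      + (1 / 2 : ℝ) * kap F * (w.zac * w.zbc)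
      + (3 / 2 : ℝ) * (1 - q) * kap F * (w.zac * w.zbc)
      + (3 / 2 : ℝ) * (1 - q) * kap F * (w.zbc * w.zbc)
      + (3 / 2 : ℝ) * (2 - q) * kap F * (w.zbc * w.z1)
      + (1 / 2 : ℝ) * (q * (1 - q)) * kap F * kap (swapAB w) := by
  simp only [imgA, wedgeH, fanCombo, conv, edgeAC, detach, V5.total, hx, hy, hz, masterN, kap, lam, swapAB, swapBC]; ring

/-- `ℓ + a_xz ≥ 0` for the `a`-image `imgA q F w`: the certificate identity (non-negative combination of valid forms). [folklore] -/
theorem imgA_ell_add_xz_eq :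
    (imgA q F w).uv + (imgA q F w).xv + (imgA q F w).yv + (imgA q F w).zv + (imgA q F w).xz =
      2 * (F.z0 * F.z0) * masterN q (swapAB w)
      + 2 * (F.z0 * F.zab) * masterN q (swapAB w)
      + q * (F.z0 * F.zac) * kap (swapAB w)
      + 4 * (F.z0 * F.zbc) * masterN q (swapAB w)
      + q * (F.zab * F.zac) * kap (swapAB w)
      + 4 * (F.zab * F.zbc) * masterN q (swapAB w)
      + (F.zac * F.zac) * masterN q (swapAB w)
      + 2 * (F.zac * F.zac) * kap (swapAB w)
      + 2 * (F.zac * F.zbc) * masterN q (swapAB w)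
      + q ^ 2 * (F.zac * F.zbc) * kap (swapAB w)
      + (q * (1 - q)) * (F.zac * F.zbc) * kap (swapAB w)
      + (2 - q) * (F.zac * F.zbc) * kap (swapAB w)
      + (F.zac * F.z1) * masterN q (swapAB w)
      + 2 * (F.zac * F.z1) * kap (swapAB w)
      + (F.zbc * F.zbc) * masterN q (swapAB w)
      + (F.zbc * F.z1) * masterN q (swapAB w)
      + 3 * masterN q F * (w.z0 * w.z0)
      + 3 * masterN q F * (w.z0 * w.zab)
      + 3 * masterN q F * (w.z0 * w.zac)
      + (3 / 2 : ℝ) * q ^ 2 * masterN q F * (w.zab * w.zac)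
      + (3 / 2 : ℝ) * (q * (1 - q)) * masterN q F * (w.zab * w.zac)
      + (3 / 2 : ℝ) * (2 - q) * masterN q F * (w.zab * w.zac)
      + masterN q F * masterN q (swapBC w)
      + (1 / 2 : ℝ) * (q * (1 - q)) * masterN q F * kap (swapBC w)
      + (1 / 2 : ℝ) * ((1 - q) * (2 - q)) * masterN q F * kap (swapBC w)
      + (2 - q) * masterN q F * kap (swapAB w)
      + 3 * kap F * masterN q (swapAB w)
      + (1 - q) ^ 2 * kap F * kap (swapAB w) := by
  simp only [imgA, wedgeH, fanCombo, conv, edgeAC, detach, V5.total, hx, hy, hz, masterN, kap, swapAB, swapBC]; ring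

/-- `ℓ + a_yz ≥ 0` for the `a`-image `imgA q F w`: the certificate identity (non-negative combination of valid forms). [folklore] -/
theorem imgA_ell_add_yz_eq :
    (imgA q F w).uv + (imgA q F w).xv + (imgA q F w).yv + (imgA q F w).zv + (imgA q F w).yz =
      3 * (F.z0 * F.z0) * masterN q (swapAB w)
      + 3 * (F.z0 * F.zab) * masterN q (swapAB w)
      + 2 * q * (F.z0 * F.zac) * (w.zab * w.zbc)
      + (2 - q) * (F.z0 * F.zac) * (w.zab * w.zbc)
      + (1 / 2 : ℝ) * q * (F.z0 * F.zac) * (w.zbc * w.zbc)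
      + 3 * (F.z0 * F.zac) * masterN q (swapAB w)
      + (q * (1 - q)) * (F.z0 * F.zac) * kap (swapAB w)
      + (1 - q) ^ 2 * (F.z0 * F.zac) * kap (swapAB w)
      + 3 * (F.z0 * F.zbc) * masterN q (swapAB w)
      + (1 - q) * (F.z0 * F.zbc) * masterN q (swapAB w)
      + 2 * (F.z0 * F.z1) * masterN q (swapAB w)
      + (1 - q) * (F.z0 * F.z1) * masterN q (swapAB w)
      + 2 * (F.zab * F.zac) * (w.zab * w.zbc)
      + q * (F.zab * F.zac) * (w.zab * w.zbc)
      + (1 / 2 : ℝ) * q * (F.zab * F.zac) * (w.zbc * w.zbc)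
      + q * (F.zab * F.zac) * masterN q (swapAB w)
      + (1 / 2 : ℝ) * (q * (1 - q)) * (F.zab * F.zac) * kap (swapAB w)
      + (1 / 2 : ℝ) * ((1 - q) * (2 - q)) * (F.zab * F.zac) * kap (swapAB w)
      + q * (F.zab * F.zbc) * masterN q (swapAB w)
      + (1 - q) * (F.zab * F.zbc) * masterN q (swapAB w)
      + q * (F.zac * F.zac) * (w.zab * w.zbc)
      + (2 - q) * (F.zac * F.zac) * (w.zab * w.zbc)
      + (F.zac * F.zac) * masterN q (swapAB w)
      + (1 - q) * (F.zac * F.zac) * kap (swapAB w)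
      + 2 * q * (F.zac * F.zbc) * (w.zab * w.zbc)
      + (2 - q) * (F.zac * F.zbc) * (w.zab * w.zbc)
      + (1 / 2 : ℝ) * q ^ 2 * (F.zac * F.zbc) * (w.zbc * w.zbc)
      + (1 / 2 : ℝ) * (q * (1 - q)) * (F.zac * F.zbc) * (w.zbc * w.zbc)
      + (F.zac * F.zbc) * masterN q (swapAB w)
      + (1 - q) * (F.zac * F.zbc) * kap (swapAB w)
      + 2 * (F.zac * F.z1) * (w.zab * w.zbc)
      + (F.zac * F.z1) * masterN q (swapAB w)
      + (1 - q) * (F.zac * F.z1) * kap (swapAB w)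
      + 2 * masterN q F * (w.z0 * w.z0)
      + 2 * masterN q F * (w.z0 * w.zab)
      + 2 * masterN q F * (w.z0 * w.zbc)
      + masterN q F * masterN q (swapBC w)
      + q * masterN q F * kap w
      + (2 - q) * masterN q F * kap w
      + masterN q F * kap (swapBC w)
      + (1 / 2 : ℝ) * (q * (1 - q)) * masterN q F * kap (swapBC w)
      + (1 / 2 : ℝ) * ((1 - q) * (2 - q)) * masterN q F * kap (swapBC w)
      + masterN q (swapAB F) * masterN q (swapAB w)
      + q * lam F * (w.zab * w.zbc)
      + (1 / 2 : ℝ) * q * lam F * (w.zbc * w.zbc)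
      + (1 / 2 : ℝ) * (2 - q) * kap F * (w.zbc * w.zbc)
      + kap F * (w.zbc * w.z1)
      + (1 - q) * kap F * lam w := by
  simp only [imgA, wedgeH, fanCombo, conv, edgeAC, detach, V5.total, hx, hy, hz, masterN, kap, lam, swapAB, swapBC]; ring

/-- `ℓ − a_xy ≥ 0` for the `a`-image `imgA q F w`: the certificate identity (non-negative combination of valid forms). [folklore] -/
theorem imgA_ell_sub_xy_eq :
    (imgA q F w).uv + (imgA q F w).xv + (imgA q F w).yv + (imgA q F w).zv - (imgA q F w).xy =
      4 * (F.z0 * F.z0) * masterN q (swapAB w)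
      + 4 * (F.z0 * F.zab) * masterN q (swapAB w)
      + 4 * (F.z0 * F.zac) * masterN q (swapAB w)
      + q * (F.z0 * F.zac) * kap (swapAB w)
      + (2 - q) * (F.z0 * F.zac) * kap (swapAB w)
      + 5 * (F.z0 * F.zbc) * masterN q (swapAB w)
      + 3 * (F.z0 * F.z1) * masterN q (swapAB w)
      + (F.zab * F.zac) * masterN q (swapAB w)
      + 2 * (F.zab * F.zac) * kap (swapAB w)
      + 2 * (F.zab * F.zbc) * masterN q (swapAB w)
      + (F.zac * F.zac) * masterN q (swapAB w)
      + 2 * (F.zac * F.zac) * kap (swapAB w)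
      + 2 * (F.zac * F.zbc) * masterN q (swapAB w)
      + q ^ 2 * (F.zac * F.zbc) * kap (swapAB w)
      + (q * (1 - q)) * (F.zac * F.zbc) * kap (swapAB w)
      + (2 - q) * (F.zac * F.zbc) * kap (swapAB w)
      + (F.zac * F.z1) * masterN q (swapAB w)
      + 2 * (F.zac * F.z1) * kap (swapAB w)
      + (1 / 2 : ℝ) * q * (F.zbc * F.zbc) * masterN q (swapAB w)
      + (1 / 2 : ℝ) * (2 - q) * (F.zbc * F.zbc) * masterN q (swapAB w)
      + q * (F.zbc * F.z1) * masterN q (swapAB w)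
      + (1 - q) * (F.zbc * F.z1) * masterN q (swapAB w)
      + 2 * masterN q F * (w.z0 * w.z0)
      + 2 * masterN q F * (w.z0 * w.zab)
      + 2 * masterN q F * (w.z0 * w.zac)
      + 2 * masterN q F * (w.zab * w.zac)
      + masterN q F * masterN q (swapBC w)
      + (1 - q) * masterN q F * kap (swapBC w)
      + (2 - q) * masterN q F * kap (swapAB w)
      + (1 - q) ^ 2 * kap F * kap (swapAB w) := by
  simp only [imgA, wedgeH, fanCombo, conv, edgeAC, detach, V5.total, hx, hy, hz, masterN, kap, swapAB, swapBC]; ring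

/-- `ℓ + a_xy ≥ 0` for the `a`-image `imgA q F w`: the certificate identity (non-negative combination of valid forms). [folklore] -/
theorem imgA_ell_add_xy_eq :
    (imgA q F w).uv + (imgA q F w).xv + (imgA q F w).yv + (imgA q F w).zv + (imgA q F w).xy =
      2 * (F.z0 * F.z0) * masterN q (swapAB w)
      + 2 * (F.z0 * F.zab) * masterN q (swapAB w)
      + 4 * (F.z0 * F.zac) * masterN q (swapAB w)
      + (2 - q) * (F.z0 * F.zac) * kap (swapAB w)
      + 3 * (F.z0 * F.zbc) * masterN q (swapAB w)
      + 3 * (F.z0 * F.z1) * masterN q (swapAB w)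
      + (F.zab * F.zac) * masterN q (swapAB w)
      + (F.zab * F.zac) * kap (swapAB w)
      + (1 / 2 : ℝ) * (q * (1 - q)) * (F.zab * F.zac) * kap (swapAB w)
      + (1 / 2 : ℝ) * ((1 - q) * (2 - q)) * (F.zab * F.zac) * kap (swapAB w)
      + (F.zac * F.zac) * masterN q (swapAB w)
      + (F.zac * F.zac) * kap (swapAB w)
      + (q * (1 - q)) * (F.zac * F.zac) * kap (swapAB w)
      + (1 - q) ^ 2 * (F.zac * F.zac) * kap (swapAB w)
      + 2 * (F.zac * F.zbc) * masterN q (swapAB w)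
      + (2 - q) * (F.zac * F.zbc) * kap (swapAB w)
      + (F.zac * F.z1) * masterN q (swapAB w)
      + 2 * (1 - q) * (F.zac * F.z1) * kap (swapAB w)
      + q ^ 2 * (F.zac * F.z1) * kap (swapAB w)
      + (q * (1 - q)) * (F.zac * F.z1) * kap (swapAB w)
      + q * (F.zbc * F.zbc) * masterN q (swapAB w)
      + (1 - q) * (F.zbc * F.zbc) * masterN q (swapAB w)
      + (F.zbc * F.z1) * masterN q (swapAB w)
      + 4 * masterN q F * (w.z0 * w.z0)
      + 4 * masterN q F * (w.z0 * w.zab)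
      + 2 * q * masterN q F * (w.z0 * w.zac)
      + 2 * (2 - q) * masterN q F * (w.z0 * w.zac)
      + 4 * masterN q F * (w.zab * w.zac)
      + masterN q F * masterN q (swapBC w)
      + (1 / 2 : ℝ) * (q * (1 - q)) * masterN q F * kap (swapBC w)
      + (1 / 2 : ℝ) * ((1 - q) * (2 - q)) * masterN q F * kap (swapBC w)
      + 2 * masterN q F * kap (swapAB w)
      + (1 - q) * kap F * kap (swapAB w) := by
  simp only [imgA, wedgeH, fanCombo, conv, edgeAC, detach, V5.total, hx, hy, hz, masterN, kap, swapAB, swapBC]; ring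

end Identities

section Signs

variable {q : ℝ} {F w : V5} (hq0 : 0 ≤ q) (hq1 : q ≤ 1) (hF : Valid q F) (hw : Valid q w)
include hq0 hq1 hF hw

/-- `ℓ − a_uy ≥ 0` for every `a`-image over `Valid × Valid` (`0 ≤ q ≤ 1`). [folklore] -/
theorem imgA_ell_sub_uy : 0 ≤ (imgA q F w).uv + (imgA q F w).xv + (imgA q F w).yv + (imgA q F w).zv - (imgA q F w).uy := by
  obtain ⟨⟨hF0, hFab, hFac, hFbc, hF1⟩, hFN, hFNab, hFNbc, hFL, hFk, hFkb, hFkc⟩ := hF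
  obtain ⟨⟨hw0, hwab, hwac, hwbc, hw1⟩, hwN, hwNab, hwNbc, hwL, hwk, hwkb, hwkc⟩ := hw
  have hp : 0 ≤ 1 - q := by linarith
  have hr : 0 ≤ 2 - q := by linarith
  rw [imgA_ell_sub_uy_eq]
  positivity

/-- `ℓ + a_xz ≥ 0` for every `a`-image over `Valid × Valid` (`0 ≤ q ≤ 1`). [folklore] -/
theorem imgA_ell_add_xz : 0 ≤ (imgA q F w).uv + (imgA q F w).xv + (imgA q F w).yv + (imgA q F w).zv + (imgA q F w).xz := by
  obtain ⟨⟨hF0, hFab, hFac, hFbc, hF1⟩, hFN, hFNab, hFNbc, hFL, hFk, hFkb, hFkc⟩ := hF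
  obtain ⟨⟨hw0, hwab, hwac, hwbc, hw1⟩, hwN, hwNab, hwNbc, hwL, hwk, hwkb, hwkc⟩ := hw
  have hp : 0 ≤ 1 - q := by linarith
  have hr : 0 ≤ 2 - q := by linarith
  rw [imgA_ell_add_xz_eq]
  positivity

/-- `ℓ + a_yz ≥ 0` for every `a`-image over `Valid × Valid` (`0 ≤ q ≤ 1`). [folklore] -/
theorem imgA_ell_add_yz : 0 ≤ (imgA q F w).uv + (imgA q F w).xv + (imgA q F w).yv + (imgA q F w).zv + (imgA q F w).yz := by
  obtain ⟨⟨hF0, hFab, hFac, hFbc, hF1⟩, hFN, hFNab, hFNbc, hFL, hFk, hFkb, hFkc⟩ := hF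
  obtain ⟨⟨hw0, hwab, hwac, hwbc, hw1⟩, hwN, hwNab, hwNbc, hwL, hwk, hwkb, hwkc⟩ := hw
  have hp : 0 ≤ 1 - q := by linarith
  have hr : 0 ≤ 2 - q := by linarith
  rw [imgA_ell_add_yz_eq]
  positivity

/-- `ℓ − a_xy ≥ 0` for every `a`-image over `Valid × Valid` (`0 ≤ q ≤ 1`). [folklore] -/
theorem imgA_ell_sub_xy : 0 ≤ (imgA q F w).uv + (imgA q F w).xv + (imgA q F w).yv + (imgA q F w).zv - (imgA q F w).xy := by
  obtain ⟨⟨hF0, hFab, hFac, hFbc, hF1⟩, hFN, hFNab, hFNbc, hFL, hFk, hFkb, hFkc⟩ := hF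
  obtain ⟨⟨hw0, hwab, hwac, hwbc, hw1⟩, hwN, hwNab, hwNbc, hwL, hwk, hwkb, hwkc⟩ := hw
  have hp : 0 ≤ 1 - q := by linarith
  have hr : 0 ≤ 2 - q := by linarith
  rw [imgA_ell_sub_xy_eq]
  positivity

/-- `ℓ + a_xy ≥ 0` for every `a`-image over `Valid × Valid` (`0 ≤ q ≤ 1`). [folklore] -/
theorem imgA_ell_add_xy : 0 ≤ (imgA q F w).uv + (imgA q F w).xv + (imgA q F w).yv + (imgA q F w).zv + (imgA q F w).xy := by
  obtain ⟨⟨hF0, hFab, hFac, hFbc, hF1⟩, hFN, hFNab, hFNbc, hFL, hFk, hFkb, hFkc⟩ := hF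
  obtain ⟨⟨hw0, hwab, hwac, hwbc, hw1⟩, hwN, hwNab, hwNbc, hwL, hwk, hwkb, hwkc⟩ := hw
  have hp : 0 ≤ 1 - q := by linarith
  have hr : 0 ≤ 2 - q := by linarith
  rw [imgA_ell_add_xy_eq]
  positivity

end Signs


end ThreeApex

end FK

end Summit.CriticalPhenomena.PercolationContinuityZ3.Theorems
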